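import Summits.BirchSwinnertonDyer.Rank1Residual.X11b.Three.RouteR1Descent
import Summits.BirchSwinnertonDyer.Rank1Residual.X11b.Three.RouteR1Tamagawa
import Summits.BirchSwinnertonDyer.Rank1Residual.X11b.Three.RouteR1GrossZagier
import Summits.BirchSwinnertonDyer.Rank1Residual.X11b.BDPRouteOddPrimeClass
import Summits.BirchSwinnertonDyer.Rank1Residual.Supersingular.X6RankOneAnticyclotomicLinksAnyField
import HarnessLib

/-!
# X11b at `p = 3`, route R1's descent from the `≥`-HALF of the display alone (LINE W≥ at erratum fields): the main-conjecture half of `BSD(E,3)`, and `BSD(E,3)` on the atom `3 ∤ ∏c` (cell `b2b-bsdres`, team `x11b3`, seat p6, sub-target S8 / LINE-W.md §C LW-B1)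

HONEST FRAMING (cell `b2b-bsdres`, run/shared/lean/b2b/bsd-rank1-residual/, verbatim in every
file): the goal of the cell is to DELETE the COMBINATION-SHAPED residual classes of the
Birch–Swinnerton-Dyer formula for ALL analytic-rank `≤ 1` elliptic curves over `ℚ` — "full BSD
formula for every rank `≤ 1` curve in class `C`" assembled STRICTLY from published theorems — so
that the rank-`≤ 1` remainder becomes exactly the CONSTRUCTION-SHAPED classes, which are TYPED
(missing-input `Prop`s), NOT attempted. This is not "finishing BSD". Team `x11b3` (N8/O2: X11b at
`p = 3`); a RESEARCH ROUTE; no claim beyond the stated class and sub-populations; X11 ∧ `r = 1` at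
`p = 3` stays CONSTRUCTION-SHAPED / O2 OPEN; nothing here books anything or changes a label.
THEOREMS ONLY (no `def`, no named fact, no `sorry`); every theorem is CONDITIONAL on ONE OPEN binder.

## What this file proves

`Three/RouteR1EndForm.lean` derives `BSD(E,3)` on route R1's population at `3` from Castella's
display (5.3) in EQUALITY form, (A|VoR)@3. The team's LINE W (`cells/x11b3/LINE-W.md` §B, planner
r1) is an architecture for the `≥`-HALF of that display only — STEP L read over ERRATUM fields:
`2·ord_3[E(K):ℤP] − ord_3 ∏_w c_w(E/K) ≤ ord_3 #Ш(E/K)[3^∞]` ((A≥|VoR)@3; its typed residue at `3` per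
LINE-W §B: MI-W3 = the Greenberg-side divisibility for the `g_m` [FW21 4.41-type, unrefereed at every
`p`], W2 = the BDP/Waldspurger value at `𝟙` for `3 ∥ N` [construction missing in print], and the
control identity at `3` [team item S3]). This file (LINE-W.md §C item LW-B1, "expose the ≥-half of
S8's open binder separately") runs route R1's descent from the `≥`-half ALONE:

* `padicVal_printShape_le_of_links` — Castella §5's bookkeeping with (A) weakened to (A≥): from
  (A≥), (B) `GZParaphraseAt`, (C) `TamagawaDescentAt` and the rank-`0` print shape of the twist
  (`PPartRankZero Wd p`, Skinner 2016 Thm. C), `L'(E,1)/(Ω_E Reg)` is a rational `q` with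
  `ord_p q ≤ ord_p #Ш(E) + ord_p ∏c_ℓ(E)` (any odd `p`; the equality version is multr1-p1's
  `padicVal_printShape_of_links`);
* `missingLowerBoundAt_of_links_lower_odd` — hence the MAIN-CONJECTURE HALF
  `Typed.MissingLowerBoundAt W p` (`ord_p #Ш_an ≤ ord_p #Ш`) at every `p ≥ 3`, through the cell's
  `≤`-bridge `Supersingular.missingLowerBoundAt_of_padicVal_printShape_le`;
* **`R1.missingLowerBoundAt_three_of_displayLower`** / `R1.forall_missingLowerBoundAt_three_of_displayLower`
  — for `W` with `IsX11Three W` on the A′ ∧ (ram2)-locus at `3` and an odd non-split ramified `q`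
  (+ an erratum field, resp. supplied by Friedberg–Hoffstein): `Typed.MissingLowerBoundAt W 3` from
  the SEVEN/EIGHT published facts of `R1.bsdp_three_of_display` and the ONE OPEN binder (A≥|VoR)@3
  — links (B)@3, (C)@3 discharged (`stub_gzParaphraseAt_three_holds`, `stub_tamagawaDescentAt_three_holds`);
* **`R1.bsdp_three_of_displayLower_of_not_dvd_tamagawaProduct`** — on the atom `3 ∤ ∏_ℓ c_ℓ(E)`
  (census3 atom A1 ∩ R1's population: the (ram) prime is the locus' `q`) the Euler-system half is a
  THEOREM from published facts (Kolyvagin / McCallum + Skinner C + Hoffstein–Luo + …,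
  `IsX11Three.missingUpperBoundAt_of_ram_of_not_dvd`, multr1-p2), so `BSD(E,3)` follows from the
  published facts of BOTH sub-cells and the `≥`-half (A≥|VoR)@3 ALONE;
* `display53Lower_of_display53At` — the equality display implies its `≥`-half (so every theorem here
  is implied by its `RouteR1EndForm` counterpart's hypothesis; the converse needs the `≤`-half, i.e.
  the Euler-system side).

## The open binder (A≥|VoR)@3 (hypothesis police, `cells/x11b3/REFEREE.md` §2; LINE-W.md §B)

Stated INLINE (no `def`): at every Manin-good Heegner datum `(Dt, H, ι, P)` (`3 ∤ c(Dt)`, `P` of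
infinite order) over an erratum field `K` for `q` meeting [Cas20, §2.5] at `N_E/3`,
`2·ord_3[E(K):ℤP] − ord_3 ∏_w c_w(E/K) ≤ ord_3 #Ш(E/K)[3^∞]`. NOT a cited fact; NO source and NO
announcement at `p = 3`. It is STEP L (`IndexLowerBoundAt`, JSW17 (eq:shalowerK-1)) in erratum-field
currency (there `ord_3 ∏_w c_w(E/K) = 2·ord_3 ∏_ℓ c_ℓ(E)` by (C)@3 and
`padicValNat_tamagawaProduct_twist_eq_of_isErratumField_odd`). Its would-be derivation is LINE W≥:
Hida family through the `3`-new form (W1: printed `p = 3` substitutes), congruences, MI-W3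
[unrefereed], W2 [construction missing], S3 [control at `3`] — see LINE-W.md §B for the statuses;
nothing of it is used or asserted here.

References: [Castella2018] §5 (arXiv:1704.06608 p. 12); [Castella2018Erratum] Thm. 1.1, Thm. A′
(p. 1); [JetchevSkinnerWan2017] §7.4.1 (eq:shalowerK-1) (arXiv:1512.06894 p. 30);
[Skinner2016PacificMC] Thm. C and footnote 1; [McCallumLMS1991] §1 Theorem (Kolyvagin);
[CaiShuTian2014] Thm. 1.1; [GrossZagier1986] Thm. I.7.3; [Mazur1978] Cor. 4.1;
[FriedbergHoffstein1995] Thm. B; [Miller2011LMS] Def. 1.1; cells/x11b3/LINE-W.md §B–§C (r1).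
-/

noncomputable section

open scoped Classical

open WeierstrassCurve NumberField Literature.NumberTheory.EllipticCurves
  Literature.NumberTheory.EllipticCurves.ModularForms
  Literature.NumberTheory.EllipticCurves.Rank1Residual
  Literature.NumberTheory.EllipticCurves.Rank1Residual.Typed
  Literature.NumberTheory.EllipticCurves.Wuthrich2014

namespace Summit.BirchSwinnertonDyer.Rank1Residual.X11b.Three

/-! ### Castella §5's bookkeeping from the `≥`-half of (5.3), any odd `p` -/

section Links

variable (W : WeierstrassCurve ℚ) [W.IsElliptic] (p : ℕ) [Fact p.Prime]

omit [W.IsElliptic] [Fact p.Prime] in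
/-- The equality display (5.3) implies its `≥`-half (bookkeeping; the `≥`-half is what LINE W≥
targets, the equality what `Three/RouteR1EndForm.lean` consumes). [folklore] -/
theorem display53Lower_of_display53At {K : Type} [Field K] [NumberField K]
    {P : (W.baseChange K).toAffine.Point} (hA : Display53At W p K P) :
    2 * (padicValNat p (AddSubgroup.zmultiples P).index : ℤ) -
        padicValNat p (W.baseChange K).tamagawaProduct ≤
      (padicValNat p (Nat.card (AddCommGroup.primaryComponent (W.baseChange K).sha p)) : ℤ) := by
  unfold Display53At at hA
  omega

/-- **Castella §5, from the `≥`-HALF of eq. (5.3) to the `≤` print shape, any odd `p`.** Let `W/ℚ`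
be elliptic with `ord_{s=1} L(E,s) = 1`, `p` odd, `K` imaginary quadratic, `Wd` a globally minimal
model of `E^{(d_K)}` with `E^{(d_K)}[p]` irreducible, `L(E^{(d_K)},1) ≠ 0` and the rank-`0` print
shape `PPartRankZero Wd p`, and `P ∈ E(K)`. If (A≥)
`2·ord_p[E(K):ℤP] − ord_p ∏_w c_w(E/K) ≤ ord_p #Ш(E/K)[p^∞]`, (B) `GZParaphraseAt W p K P Wd` and (C)
`TamagawaDescentAt W p K Wd` hold, then `L'(E,1)/(Ω_E·Reg(E/ℚ))` is a rational `q` with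
`ord_p q ≤ ord_p #Ш(E/ℚ) + ord_p ∏_ℓ c_ℓ(E/ℚ)`. multr1-p1's `padicVal_printShape_of_links` VERBATIM
with the equality (A) weakened to (A≥) (adapted from `X11b/CastellaErratumChain.lean`): Gross–Zagier
1986 Thm. I.7.3 (`hGZ`, rationality), GZK (`hGZK`), `#Ш(E/K)[p^∞] = #Ш(E)[p^∞]·#Ш(E^D)[p^∞]` (odd
`p`, tree theorem), Mazur's torsion bound via `irr`; then
`ord Ш(E) + ord Ш(E^D) ≥ 2 ord I − ord ∏c(E) − ord ∏c(E^D) = ord q + ord q_D − ord ∏c(E) − ord ∏c(E^D)`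
and `ord q_D = ord Ш(E^D) + ord ∏c(E^D)`. [cite: Castella2018, §5 (arXiv:1704.06608 p. 12), eqs. (5.3) to the end]
[cite: GrossZagier1986, Thm. I.7.3] -/
theorem padicVal_printShape_le_of_links
    (hGZ : GrossZagier1986_thm_I_7_3) (hGZK : rank_eq_analyticRank_of_analyticRank_le_one)
    (hp : p ≠ 2) (hr : W.analyticRank = 1)
    (K : Type) [Field K] [NumberField K] (hK : IsImaginaryQuadratic K)
    (Wd : WeierstrassCurve ℚ) [Wd.IsElliptic] [Wd.IsGloballyMinimal]
    (hWd : ∃ C : VariableChange ℚ, C • W.quadraticTwist (NumberField.discr K : ℚ) = Wd)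
    (hirrd : Irr Wd p) (hLd : Wd.entireLFunction 1 ≠ 0) (hD : PPartRankZero Wd p)
    (P : (W.baseChange K).toAffine.Point)
    (hA : 2 * (padicValNat p (AddSubgroup.zmultiples P).index : ℤ) -
        padicValNat p (W.baseChange K).tamagawaProduct ≤
      (padicValNat p (Nat.card (AddCommGroup.primaryComponent (W.baseChange K).sha p)) : ℤ))
    (hB : GZParaphraseAt W p K P Wd) (hC : TamagawaDescentAt W p K Wd) :
    ∃ q : ℚ, W.leadingLCoeff / ((W.realPeriodRat * W.regulator : ℝ) : ℂ) = (q : ℂ) ∧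
      padicValRat p q ≤ (padicValNat p W.shaOrder : ℤ) + padicValNat p W.tamagawaProduct := by
  obtain ⟨hrank, hfin⟩ := hGZK W (le_of_eq hr)
  have hrk : W.mordellWeilRank = 1 := by omega
  obtain ⟨q, -, hqL⟩ := leadingLCoeff_eq_rat_mul_of_analyticRank_eq_one (W := W) hGZ hr hrk
  have hΩ : (0 : ℝ) < W.realPeriodRat := W.realPeriodRat_pos_holds
  have hR : (0 : ℝ) < W.regulator := W.regulator_pos'
  have hΩR : ((W.realPeriodRat * W.regulator : ℝ) : ℂ) ≠ 0 := by
    exact_mod_cast (mul_pos hΩ hR).ne'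
  have hq : W.leadingLCoeff / ((W.realPeriodRat * W.regulator : ℝ) : ℂ) = (q : ℂ) := by
    rw [div_eq_iff hΩR, hqL]
    push_cast
    ring
  obtain ⟨qd, hqd, hvd⟩ := hD
  have hrd : Wd.analyticRank = 0 :=
    Literature.NumberTheory.EllipticCurves.analyticRank_eq_zero_of_entireLFunction_one_ne_zero Wd hLd
  obtain ⟨-, hfind⟩ := hGZK Wd (by omega)
  haveI : Finite W.sha := hfin
  haveI : Finite Wd.sha := hfind
  haveI : Finite (AddCommGroup.primaryComponent W.sha p) :=
    Finite.of_injective _ Subtype.val_injective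
  haveI : Finite (AddCommGroup.primaryComponent Wd.sha p) :=
    Finite.of_injective _ Subtype.val_injective
  have htorsd : padicValNat p Wd.torsionOrder = 0 :=
    padicValNat_torsionOrder_eq_zero_of_irreducible Wd p hirrd
  -- `#Ш(E/K)[p^∞] = #Ш(E)[p^∞] · #Ш(E^D)[p^∞]` (PROVED tree theorem, odd `p`)
  haveI : (W.baseChange K).IsElliptic := by rw [WeierstrassCurve.baseChange]; infer_instance
  have hdec := W.card_primaryComponent_sha_baseChange_quadratic_of_odd_of_finite K hK.1 Wd hWd
    (W.baseChange K) ⟨1, one_smul _ _⟩ p hp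
  have hShaK : padicValNat p (Nat.card (AddCommGroup.primaryComponent (W.baseChange K).sha p)) =
      padicValNat p W.shaOrder + padicValNat p Wd.shaOrder := by
    rw [hdec, padicValNat.mul (Nat.card_pos).ne' (Nat.card_pos).ne',
      padicValNat_card_addPrimaryComponent, padicValNat_card_addPrimaryComponent]
    rfl
  have hBv := hB q qd hq hqd
  refine ⟨q, hq, ?_⟩
  unfold TamagawaDescentAt at hC
  have hC' : (padicValNat p (W.baseChange K).tamagawaProduct : ℤ) =
      padicValNat p W.tamagawaProduct + padicValNat p Wd.tamagawaProduct := by exact_mod_cast hC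
  have hS' : (padicValNat p (Nat.card (AddCommGroup.primaryComponent (W.baseChange K).sha p)) : ℤ)
      = padicValNat p W.shaOrder + padicValNat p Wd.shaOrder := by exact_mod_cast hShaK
  have ht' : (padicValNat p Wd.torsionOrder : ℤ) = 0 := by exact_mod_cast htorsd
  linarith

/-- **The main-conjecture half from the `≥`-half of (5.3), per pair, at every `p ≥ 3`:** with the
rank-`0` print shape of the twist TAKEN FROM PRINT — Skinner, Pacific J. Math. 283 (2016) Thm. C
(`hSk`, `p ≥ 3`, for `Wd`: multiplicative at `p`, `E^D[p]` irreducible, a multiplicative `ℓ ≠ p` with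
`p ∤ v_ℓ(Δ_min(Wd))`, `L(E^D,1) ≠ 0`, `Ш(E^D)` finite by GZK) — the links (A≥), (B), (C) give
`Typed.MissingLowerBoundAt W p` (`ord_p #Ш(E)_an ≤ ord_p #Ш(E)`) through
`padicVal_printShape_le_of_links` and the cell's `≤`-bridge
`Supersingular.missingLowerBoundAt_of_padicVal_printShape_le` (irreducibility of `E[p]` kills the
torsion term). The lower-half analogue of `bsdp_of_links_odd`. [cite: Castella2018, §5 (arXiv:1704.06608 p. 12), last step]
[cite: Skinner2016PacificMC, Thm. C (§1) and footnote 1] [cite: Miller2011LMS, §1 and Def. 1.1] -/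
theorem missingLowerBoundAt_of_links_lower_odd
    (hGZ : GrossZagier1986_thm_I_7_3) (hGZK : rank_eq_analyticRank_of_analyticRank_le_one)
    (hSk : Skinner2016.thmC_padicValRat_bsd_rank_zero)
    (hp3 : 3 ≤ p) (hirr : Irr W p) (hr : W.analyticRank = 1)
    (K : Type) [Field K] [NumberField K] (hK : IsImaginaryQuadratic K)
    (Wd : WeierstrassCurve ℚ) [Wd.IsElliptic] [Wd.IsGloballyMinimal]
    (hWd : ∃ C : VariableChange ℚ, C • W.quadraticTwist (NumberField.discr K : ℚ) = Wd)
    (hLd : Wd.entireLFunction 1 ≠ 0) (hmultd : Mult Wd p) (hirrd : Irr Wd p)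
    (hramd : ∃ (ℓ : ℕ) (_ : Fact ℓ.Prime), ℓ ≠ p ∧ Mult Wd ℓ ∧
      ¬ p ∣ padicValInt ℓ Wd.minimalDiscriminantInt)
    (P : (W.baseChange K).toAffine.Point)
    (hA : 2 * (padicValNat p (AddSubgroup.zmultiples P).index : ℤ) -
        padicValNat p (W.baseChange K).tamagawaProduct ≤
      (padicValNat p (Nat.card (AddCommGroup.primaryComponent (W.baseChange K).sha p)) : ℤ))
    (hB : GZParaphraseAt W p K P Wd) (hC : TamagawaDescentAt W p K Wd) :
    Typed.MissingLowerBoundAt W p := by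
  have hrd : Wd.analyticRank = 0 :=
    Literature.NumberTheory.EllipticCurves.analyticRank_eq_zero_of_entireLFunction_one_ne_zero Wd hLd
  obtain ⟨-, hfind⟩ := hGZK Wd (by omega)
  have hD : PPartRankZero Wd p := hSk Wd p hp3 (Or.inr hmultd) hirrd hramd hLd hfind
  exact Supersingular.missingLowerBoundAt_of_padicVal_printShape_le W p hirr
    (padicVal_printShape_le_of_links W p hGZ hGZK (by omega) hr K hK Wd hWd hirrd hLd hD P hA hB hC)

end Links

/-! ### Route R1's descent at `p = 3` from the `≥`-half: the main-conjecture half of `BSD(E,3)` -/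

section Three

/-- **The main-conjecture half of `BSD(E,3)` on route R1's population from the `≥`-HALF of the
display — per pair, with a GIVEN erratum field.** For `W/ℚ` globally minimal with `IsX11Three W` on
the A′ ∧ (ram2)-locus at `3`, an odd prime `q ≠ 3` of non-split multiplicative reduction with
`3 ∤ v_q(Δ_min)`, and an erratum field `K` for `q`: `Typed.MissingLowerBoundAt W 3`
(`ord_3 #Ш(E)_an ≤ ord_3 #Ш(E)`) from the SEVEN published named facts of `R1.bsdp_three_of_display`
(`hGZ`, `hGZK`, `hSk`, `hmod`, `hCST`, `hMaz`, `hNS`) and the ONE OPEN binder `hA` = (A≥|VoR)@3 —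
the `≥`-half of Castella's display (5.3) at `3` (= STEP L in erratum-field currency) at every
Manin-good Heegner datum over erratum fields meeting [Cas20, §2.5] (NOT a cited fact; no source,
no announcement at `3`; LINE W≥'s architecture, LINE-W.md §B, would supply it from MI-W3 ∘ W2 ∘
S3). Proof = the body of `R1.bsdp_three_of_display_skeleton` (second ramified prime from the locus;
`cas20Standing_of_isErratumField_odd`; Manin-good datum; Heegner point of infinite order; globally
minimal twist model; transports at the split primes `3`, `ℓ`), with the links (B)@3, (C)@3
DISCHARGED (`stub_gzParaphraseAt_three_holds`, `stub_tamagawaDescentAt_three_holds`) and the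
lower-half bookkeeping `missingLowerBoundAt_of_links_lower_odd`. CONDITIONAL on `hA`; deletes
nothing; X11 ∧ `r = 1` at `3` stays CONSTRUCTION-SHAPED. [cite: Castella2018, §5 (arXiv:1704.06608 p. 12)]
[cite: JetchevSkinnerWan2017, §7.4.1 (eq:shalowerK-1) (arXiv:1512.06894 p. 30)]
[cite: Castella2018Erratum, Thm. A′ (p. 1) with "p > 3" read as "p = 3" (shape only; nothing asserted)] -/
theorem R1.missingLowerBoundAt_three_of_displayLower
    (hGZ : GrossZagier1986_thm_I_7_3) (hGZK : rank_eq_analyticRank_of_analyticRank_le_one)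
    (hSk : Skinner2016.thmC_padicValRat_bsd_rank_zero) (hmod : exists_isNewformOf)
    (hCST : CaiShuTian2014.thm11_trivialChar)
    (hMaz : mazur_not_dvd_maninConstant_of_odd) (hNS : integral_neronScaling_of_isGloballyMinimal)
    -- OPEN: (A≥|VoR)@3 — the `≥`-half of the display (5.3) at `p = 3` over erratum fields
    (hA : ∀ (W : WeierstrassCurve ℚ) [W.IsElliptic] [W.IsGloballyMinimal] [NeZero (W.conductorNorm ℤ)]
        (q : ℕ) [Fact q.Prime] (K : Type) [Field K] [NumberField K]
        (Dt : ModularParametrizationData W (W.conductorNorm ℤ))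
        (H : HeegnerDatum (W.conductorNorm ℤ) (NumberField.discr K)) (ι : K →+* ℂ)
        (P : (W.baseChange K).toAffine.Point),
        IsX11Three W → X11.AprimeLocusAt W 3 → q ≠ 3 → Mult W q →
        ¬ W.HasSplitMultiplicativeReductionAtPrime q → ¬ 3 ∣ padicValInt q W.minimalDiscriminantInt →
        IsErratumField W K q → Cas20Standing K 3 (W.conductorNorm ℤ / 3) →
        WeierstrassCurve.Affine.Point.map ι.toRatAlgHom P = heegnerPointComplex Dt H →
        ¬ (3 : ℤ) ∣ Dt.c → ¬ IsOfFinAddOrder P →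
        2 * (padicValNat 3 (AddSubgroup.zmultiples P).index : ℤ) -
            padicValNat 3 (W.baseChange K).tamagawaProduct ≤
          (padicValNat 3 (Nat.card (AddCommGroup.primaryComponent (W.baseChange K).sha 3)) : ℤ))
    (W : WeierstrassCurve ℚ) [W.IsElliptic] [W.IsGloballyMinimal]
    (hX : IsX11Three W) (hloc : X11.AprimeRam2LocusAt W 3)
    (q : ℕ) [Fact q.Prime] (hq2 : q ≠ 2) (hq3 : q ≠ 3) (hmq : Mult W q)
    (hnsq : ¬ W.HasSplitMultiplicativeReductionAtPrime q)
    (hvq : ¬ 3 ∣ padicValInt q W.minimalDiscriminantInt)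
    (K : Type) [Field K] [NumberField K] (hKf : IsErratumField W K q) :
    Typed.MissingLowerBoundAt W 3 := by
  haveI : NeZero (W.conductorNorm ℤ) := ⟨(W.conductorNorm_pos_holds).ne'⟩
  have hmodE : hasEntireLFunction_rat := hasEntireLFunction_rat_of_exists_isNewformOf hmod
  have hmult : Mult W 3 := hX.mult
  have hirr : Irr W 3 := hX.irr
  have hr : W.analyticRank = 1 := hX.rank
  have hloc' : X11.AprimeLocusAt W 3 := X11.aprimeLocusAt_of_aprimeRam2LocusAt hloc
  -- a second ramified multiplicative prime `ℓ ∉ {3, q}` from the (ram2) locus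
  obtain ⟨ℓ, hℓF, hℓp, hℓq, hmℓ, hvℓ⟩ : ∃ (ℓ : ℕ) (_ : Fact ℓ.Prime), ℓ ≠ 3 ∧ ℓ ≠ q ∧ Mult W ℓ ∧
      ¬ 3 ∣ padicValInt ℓ W.minimalDiscriminantInt := by
    obtain ⟨⟨q₀, hq₀F, ℓ₀, hℓ₀F, hq₀p, hℓ₀p, hℓ₀q₀, hmq₀, -, hvq₀, hmℓ₀, hvℓ₀⟩, -⟩ := hloc
    by_cases h : q₀ = q
    · subst h
      exact ⟨ℓ₀, hℓ₀F, hℓ₀p, hℓ₀q₀, hmℓ₀, hvℓ₀⟩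
    · exact ⟨q₀, hq₀F, hq₀p, h, hmq₀, hvq₀⟩
  have hVoR : Cas20Standing K 3 (W.conductorNorm ℤ / 3) :=
    cas20Standing_of_isErratumField_odd W 3 (by decide) hmult hq3 hq2 hmq hKf
  obtain ⟨Dt, hc⟩ := exists_modularParametrizationData_not_dvd hmod hMaz hNS W rfl Nat.prime_three
    (by decide) (not_sq_dvd_conductorNorm_of_mult W 3 hmult) hirr
  obtain ⟨H, ι, P, hP, hnt⟩ :=
    heegnerDatumSupply_of_caiShuTian W hmodE
      (CaiShuTian2014.exists_isHeegnerPoint_of_heegnerCondition_of_modularity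
        (nonempty_modularParametrizationData_iff_exists_isNewformOf_unconditional.mpr hmod))
      CaiShuTian2014.exists_map_eq_heegnerPointComplex_of_heegnerCondition_holds hCST hr hmq hnsq
      hKf Dt
  have hd0 : (NumberField.discr K : ℚ) ≠ 0 := by exact_mod_cast NumberField.discr_ne_zero K
  haveI := W.isElliptic_quadraticTwist hd0
  obtain ⟨C, hCmin⟩ := hasGlobalMinimalModel_rat_holds (W.quadraticTwist (NumberField.discr K : ℚ))
  set Wd := C • W.quadraticTwist (NumberField.discr K : ℚ) with hWd_def
  haveI : Wd.IsGloballyMinimal := hCmin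
  have hWd : ∃ C' : VariableChange ℚ, C' • W.quadraticTwist (NumberField.discr K : ℚ) = Wd :=
    ⟨C, rfl⟩
  obtain ⟨htm, hti, htr⟩ := twistTransportAt_of_twist W 3 hKf.1 Wd hWd
  have hsp : SplitsIn K 3 := hKf.splitsIn_of_mult hmult (Ne.symm hq3)
  have hsℓ : SplitsIn K ℓ := hKf.splitsIn_of_mult hmℓ hℓq
  have hmultd : Mult Wd 3 := htm hsp hmult
  have hirrd : Irr Wd 3 := hti hirr
  obtain ⟨hmℓd, hvℓd⟩ := htr ℓ hℓp hsℓ hmℓ hvℓ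
  have hLd : Wd.entireLFunction 1 ≠ 0 := by
    rw [hWd_def, WeierstrassCurve.entireLFunction_smul]
    exact hKf.2.2.2.2
  exact missingLowerBoundAt_of_links_lower_odd W 3 hGZ hGZK hSk le_rfl hirr hr K hKf.1 Wd hWd hLd
    hmultd hirrd ⟨ℓ, hℓF, hℓp, hmℓd, hvℓd⟩ P
    (hA W q K Dt H ι P hX hloc' hq3 hmq hnsq hvq hKf hVoR hP hc hnt)
    (stub_gzParaphraseAt_three_holds hGZK hmodE hCST W q K Dt H ι P Wd C hr hirr hq2 hmq hnsq hKf
      hsp hP hc hnt rfl)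
    (stub_tamagawaDescentAt_three_holds W q K Wd hq2 hmq hvq hKf hWd)

/-- **The main-conjecture half of `BSD(E,3)` on route R1's population from the `≥`-half, class
level — the field supplied.** For EVERY globally minimal elliptic `W/ℚ` with `IsX11Three W` on the
A′ ∧ (ram2)-locus at `3` having an odd non-split multiplicative `q ≠ 3` with `3 ∤ v_q(Δ_min)`:
`Typed.MissingLowerBoundAt W 3`, from EIGHT published named facts (the seven above and `hFH`
Friedberg–Hoffstein 1995 Thm. B, `erratumField_supply`) and the ONE OPEN binder (A≥|VoR)@3.
CONDITIONAL; deletes nothing. [cite: Castella2018, §5 (arXiv:1704.06608 p. 12)]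
[cite: FriedbergHoffstein1995, Thm. B (special case)] [cite: JetchevSkinnerWan2017, §7.4.1 (eq:shalowerK-1)] -/
theorem R1.forall_missingLowerBoundAt_three_of_displayLower
    (hGZ : GrossZagier1986_thm_I_7_3) (hGZK : rank_eq_analyticRank_of_analyticRank_le_one)
    (hSk : Skinner2016.thmC_padicValRat_bsd_rank_zero) (hmod : exists_isNewformOf)
    (hCST : CaiShuTian2014.thm11_trivialChar)
    (hFH : friedbergHoffstein_exists_twist_ne_zero_ramifiedAt)
    (hMaz : mazur_not_dvd_maninConstant_of_odd) (hNS : integral_neronScaling_of_isGloballyMinimal)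
    (hA : ∀ (W : WeierstrassCurve ℚ) [W.IsElliptic] [W.IsGloballyMinimal] [NeZero (W.conductorNorm ℤ)]
        (q : ℕ) [Fact q.Prime] (K : Type) [Field K] [NumberField K]
        (Dt : ModularParametrizationData W (W.conductorNorm ℤ))
        (H : HeegnerDatum (W.conductorNorm ℤ) (NumberField.discr K)) (ι : K →+* ℂ)
        (P : (W.baseChange K).toAffine.Point),
        IsX11Three W → X11.AprimeLocusAt W 3 → q ≠ 3 → Mult W q →
        ¬ W.HasSplitMultiplicativeReductionAtPrime q → ¬ 3 ∣ padicValInt q W.minimalDiscriminantInt →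
        IsErratumField W K q → Cas20Standing K 3 (W.conductorNorm ℤ / 3) →
        WeierstrassCurve.Affine.Point.map ι.toRatAlgHom P = heegnerPointComplex Dt H →
        ¬ (3 : ℤ) ∣ Dt.c → ¬ IsOfFinAddOrder P →
        2 * (padicValNat 3 (AddSubgroup.zmultiples P).index : ℤ) -
            padicValNat 3 (W.baseChange K).tamagawaProduct ≤
          (padicValNat 3 (Nat.card (AddCommGroup.primaryComponent (W.baseChange K).sha 3)) : ℤ)) :
    ∀ (W : WeierstrassCurve ℚ) [W.IsElliptic] [W.IsGloballyMinimal],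
      IsX11Three W → X11.AprimeRam2LocusAt W 3 →
      (∃ (q : ℕ) (_ : Fact q.Prime), q ≠ 2 ∧ q ≠ 3 ∧ Mult W q ∧
        ¬ W.HasSplitMultiplicativeReductionAtPrime q ∧ ¬ 3 ∣ padicValInt q W.minimalDiscriminantInt) →
      Typed.MissingLowerBoundAt W 3 := by
  intro W _ _ hX hloc ⟨q, hqF, hq2, hq3, hmq, hnsq, hvq⟩
  obtain ⟨K, _, _, hKf⟩ := erratumField_supply hmod hFH W 3 q hX.rank hmq hnsq
  exact R1.missingLowerBoundAt_three_of_displayLower hGZ hGZK hSk hmod hCST hMaz hNS hA W hX hloc q hq2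
    hq3 hmq hnsq hvq K hKf

/-- **`BSD(E,3)` on route R1's population ∩ {`3 ∤ ∏_ℓ c_ℓ(E)`} from the `≥`-HALF ALONE.** For
`W/ℚ` globally minimal with `IsX11Three W` on the A′ ∧ (ram2)-locus at `3` with an odd non-split
ramified `q` and `3 ∤ ∏_ℓ c_ℓ(E)` (census3 atom A1: the locus' `q` is a (ram) prime): `BSD(E,3)`,
from the published named facts of BOTH sub-cells — route R1's (`hGZ1` GZ86 I.7.3, `hGZK`, `hSk`,
`hnf` modularity, `hCST`, `hFH`, `hMaz`, `hNS`) and the Euler-system side's (`hGZ` Gross–Zagier,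
`hKo`, `hB` Kolyvagin 1990 / McCallum 1991 with Tamagawa defect, `hmod`, `hHL` Hoffstein–Luo) — and
the ONE OPEN binder (A≥|VoR)@3: the UPPER half `ord_3 #Ш ≤ ord_3 #Ш_an` is multr1-p2's THEOREM
`IsX11Three.missingUpperBoundAt_of_ram_of_not_dvd` (Kolyvagin at a classical Heegner field, defect
`2·ord_3 ∏c = 0`), the LOWER half is `R1.forall_missingLowerBoundAt_three_of_displayLower`, and the
two halves make `BSD(E,3)` (`Typed.missingPPartAt_of_lower_of_upper`, `Typed.bsdp_of_missingPPartAt`).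
So on R1's population ∩ A1 the kernel asks of the literature EXACTLY the `≥`-direction that LINE W≥
(LINE-W.md §B) is designed to supply — nothing on the Euler-system side. CONDITIONAL on `hA`;
deletes nothing; X11 ∧ `r = 1` at `3` stays CONSTRUCTION-SHAPED; no label change.
[cite: McCallumLMS1991, §1 Theorem (Kolyvagin), p. 296] [cite: Castella2018, §5 (arXiv:1704.06608 p. 12)]
[cite: JetchevSkinnerWan2017, §7.4.1 (eq:shalowerK-1)] [cite: Miller2011LMS, Def. 1.1] -/
theorem R1.bsdp_three_of_displayLower_of_not_dvd_tamagawaProduct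
    -- Euler-system side (multr1-p2's `IsX11Three.missingUpperBoundAt_of_ram_of_not_dvd`)
    (hGZ : ∀ (N : ℕ) [NeZero N] (W : WeierstrassCurve ℚ) (K : Type) [Field K] [NumberField K],
      gross_zagier N W K)
    (hKo : ∀ (N : ℕ) [NeZero N] (W : WeierstrassCurve ℚ) (K : Type) [Field K] [NumberField K],
      kolyvagin N W K)
    (hB : ∀ (N : ℕ) [NeZero N] (W : WeierstrassCurve ℚ) (K : Type) [Field K] [NumberField K],
      Kolyvagin1990_padicValNat_card_sha_le N W K)
    (hSk : Skinner2016.thmC_padicValRat_bsd_rank_zero)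
    (hGZK : rank_eq_analyticRank_of_analyticRank_le_one) (hmod : hasEntireLFunction_rat)
    (hnf : exists_isNewformOf) (hHL : HoffsteinLuo1997_exists_twist_L_one_ne_zero)
    (hMaz : mazur_not_dvd_maninConstant_of_odd) (hNS : integral_neronScaling_of_isGloballyMinimal)
    -- route R1's further published inputs
    (hGZ1 : GrossZagier1986_thm_I_7_3) (hCST : CaiShuTian2014.thm11_trivialChar)
    (hFH : friedbergHoffstein_exists_twist_ne_zero_ramifiedAt)
    -- OPEN: (A≥|VoR)@3
    (hA : ∀ (W : WeierstrassCurve ℚ) [W.IsElliptic] [W.IsGloballyMinimal] [NeZero (W.conductorNorm ℤ)]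
        (q : ℕ) [Fact q.Prime] (K : Type) [Field K] [NumberField K]
        (Dt : ModularParametrizationData W (W.conductorNorm ℤ))
        (H : HeegnerDatum (W.conductorNorm ℤ) (NumberField.discr K)) (ι : K →+* ℂ)
        (P : (W.baseChange K).toAffine.Point),
        IsX11Three W → X11.AprimeLocusAt W 3 → q ≠ 3 → Mult W q →
        ¬ W.HasSplitMultiplicativeReductionAtPrime q → ¬ 3 ∣ padicValInt q W.minimalDiscriminantInt →
        IsErratumField W K q → Cas20Standing K 3 (W.conductorNorm ℤ / 3) →
        WeierstrassCurve.Affine.Point.map ι.toRatAlgHom P = heegnerPointComplex Dt H →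
        ¬ (3 : ℤ) ∣ Dt.c → ¬ IsOfFinAddOrder P →
        2 * (padicValNat 3 (AddSubgroup.zmultiples P).index : ℤ) -
            padicValNat 3 (W.baseChange K).tamagawaProduct ≤
          (padicValNat 3 (Nat.card (AddCommGroup.primaryComponent (W.baseChange K).sha 3)) : ℤ))
    (W : WeierstrassCurve ℚ) [W.IsElliptic] [W.IsGloballyMinimal]
    (hX : IsX11Three W) (hloc : X11.AprimeRam2LocusAt W 3)
    (hq : ∃ (q : ℕ) (_ : Fact q.Prime), q ≠ 2 ∧ q ≠ 3 ∧ Mult W q ∧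
      ¬ W.HasSplitMultiplicativeReductionAtPrime q ∧ ¬ 3 ∣ padicValInt q W.minimalDiscriminantInt)
    (htam : ¬ 3 ∣ W.tamagawaProduct) : BSDp W 3 := by
  have hram : Ram W 3 := X11.ram_of_aprimeLocusAt (X11.aprimeLocusAt_of_aprimeRam2LocusAt hloc)
  have hup : Typed.MissingUpperBoundAt W 3 :=
    IsX11Three.missingUpperBoundAt_of_ram_of_not_dvd hGZ hKo hB hSk hGZK hmod hnf hHL hMaz hNS W hX
      hram htam
  have hlow : Typed.MissingLowerBoundAt W 3 :=
    R1.forall_missingLowerBoundAt_three_of_displayLower hGZ1 hGZK hSk hnf hCST hFH hMaz hNS hA W hX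
      hloc hq
  exact Typed.bsdp_of_missingPPartAt W 3 hGZK (le_of_eq hX.rank)
    (Typed.missingPPartAt_of_lower_of_upper W 3 hlow hup)

end Three

end Summit.BirchSwinnertonDyer.Rank1Residual.X11b.Three

end
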